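import Summits.BirchSwinnertonDyer.BirchSwinnertonDyer.Theorems.Rank2ObservatoryRank3TwoDescCensus
import Summits.BirchSwinnertonDyer.BirchSwinnertonDyer.Theorems.Rank2ObservatoryRank3TwoDescCensusPart9
import Summits.BirchSwinnertonDyer.BirchSwinnertonDyer.Theorems.Rank2ObservatoryRank3TwoDescCensusPart10
import HarnessLib

/-!
# BirchSwinnertonDyer — rank ≥ 2 observatory: KERNEL-2DESC rank-3 CENSUS AGGREGATE, FINAL (993 rows of `rank3Table`, `rank_ℤ = 3` hypothesis-free)

HONEST FRAMING: per-curve certified theorems and census instruments; no claim on BSD in rank ≥ 2.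

`TwoDescRank3Census.Final.rows` (DATA) = `TwoDescRank3Census.rows ++ (Part9.rows ++ Part10.rows)` lists ALL 993 rows of the
rank-3 census table `rank3Table` (9 487 rows) joined by the census-join files `Rank2ObservatoryRank3TwoDescRows001 … 113`
(113 files): the 962 rows of the landed aggregate `Rank2ObservatoryRank3TwoDescCensus` (parts 1–8) followed by the 31 rows
joined afterwards (parts 9, 10; the tree is append-only, so the landed `rows` is extended in a new
file rather than rewritten).  These are EXACTLY the tier-0 rows of the KERNEL-2DESC rank-3 instrument: the odd-torsion rows of
`rank3Table` whose cubic 2-division field K = ℚ(θ) has ℤ[θ′] = 𝓞_K for the tabulated generator, class number 1, and a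
3-dimensional norm/sign-sieved subgroup of K(S,2) (feasibility census kit j130564: 993 rows), each with its per-curve general
2-descent `Rank2Observatory<label>TwoDescRankThree.lean` (exactly 8 admissible classes by `decide`; Cassels' `x − θ` map) in
the tree.  For every listed row BOTH `r ∈ rank3Table` and `rank_ℤ(E_r(ℚ)) = 3` hold with NO hypothesis (`mem_rank3Table`,
`rank_eq_three`, glued by `List.forall_mem_append`; nothing is re-checked here).  `rows_length : rows.length = 993`.  Sorry-free.
The other 8494 rows of `rank3Table` are outside this instrument: the 986 rows with a rational 2-torsion point have
`rank_ℤ = 3` hypothesis-free since gen 8 (`Rank2ObservatoryRank3FullTwoTorsion`, `Rank2ObservatoryRank3IsoCensus`), and the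
remaining 7508 odd-torsion rows keep the 2-descent upper bound as the named hypothesis `hup` of the census theorems
(their 2-division field is non-monogenic for the tabulated generator, has class number > 1, or the norm/sign sieve leaves
16 or 32 classes).
References: J. W. S. Cassels, *Lectures on Elliptic Curves* (1991) §15; J. E. Cremona, *Algorithms for Modular Elliptic
Curves* (2nd ed. 1997) Tables, §3.5, §3.6.
-/

-- single-conjunct summit: `Summit.BirchSwinnertonDyer.BirchSwinnertonDyer.…` repeats the name by design
set_option linter.dupNamespace false
-- deep literal lists behind the part definitions: raise the recursion budget for the whole file
set_option maxRecDepth 400000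

namespace Summit.BirchSwinnertonDyer.BirchSwinnertonDyer.Rank2Observatory.TwoDescRank3Census.Final

open Literature Literature.NumberTheory.EllipticCurves WeierstrassCurve

/-- `∀`-over-membership is additive under `++`. -/
private theorem forall_app {P : Rank3Row → Prop} {l₁ l₂ : List Rank3Row} (h₁ : ∀ r ∈ l₁, P r) (h₂ : ∀ r ∈ l₂, P r) :
    ∀ r ∈ l₁ ++ l₂, P r :=
  List.forall_mem_append.2 ⟨h₁, h₂⟩

/-- DATA: all 993 joined rows = the landed 962-row aggregate `TwoDescRank3Census.rows` followed by the new parts. [cite: CremonaAlgorithms1997, Tables] -/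
def rows : List Rank3Row :=
  TwoDescRank3Census.rows ++ (Part9.rows ++ (Part10.rows))

/-- `rows.length = 993` (= 962 + 30 + 1). -/
theorem rows_length : rows.length = 993 := by
  simp only [rows, List.length_append, TwoDescRank3Census.rows_length, Part9.rows_length, Part10.rows_length]

/-- **Every listed row is a row of the census table `rank3Table`.** [cite: CremonaAlgorithms1997, Tables] -/
theorem mem_rank3Table : ∀ r ∈ rows, r ∈ rank3Table := by
  unfold rows
  exact forall_app TwoDescRank3Census.mem_rank3Table (forall_app Part9.mem_rank3Table (Part10.mem_rank3Table))

/-- **`rank_ℤ E_r(ℚ) = 3` for every one of the 993 listed census rows, NO hypothesis** (kernel 2-descent upper bound +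
kernel point certificate, per row). [cite: Cassels1991LecturesEllipticCurves, §15] [cite: CremonaAlgorithms1997, §3.5] -/
theorem rank_eq_three : ∀ r ∈ rows, r.curve.mordellWeilRank = 3 := by
  unfold rows
  exact forall_app TwoDescRank3Census.rank_eq_three (forall_app Part9.rank_eq_three (Part10.rank_eq_three))

/-- Both facts per listed row. [cite: CremonaAlgorithms1997, Tables] -/
theorem rank_eq_three_and_mem : ∀ r ∈ rows, r ∈ rank3Table ∧ r.curve.mordellWeilRank = 3 :=
  fun r hr => ⟨mem_rank3Table r hr, rank_eq_three r hr⟩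

/-- **`L(E_r,1) = 0` and `L′(E_r,1) = 0` exactly, for every one of the 993 listed rows**, given ONLY Gross–Zagier–Kolyvagin
(`hGZK` = bsd.S17: `r_an ≤ 1 ⇒ rank_ℤ ≤ 1`); the rank input `3 ≤ rank_ℤ` is the kernel theorem `rank_eq_three`.
[cite: CremonaAlgorithms1997, §2.13] [cite: Darmon2004, Thm. 3.22] -/
theorem lvalues_eq_zero (hGZK : rank_eq_analyticRank_of_analyticRank_le_one) :
    ∀ r ∈ rows, r.curve.entireLFunction 1 = 0 ∧ deriv r.curve.entireLFunction 1 = 0 :=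
  fun r hr => Rank3Row.lvalues_eq_zero_of_three_le (mem_rank3Table r hr) hGZK (rank_eq_three r hr).ge

/-- **CENSUS THEOREM over all 993 listed rows: `r_an(E_r) = rank_ℤ E_r(ℚ) = 3`** with BOTH rank fields of the census
(`hlow : 3 ≤ rank_ℤ`, `hup : rank_ℤ ≤ 3`) DISCHARGED by the kernel (`rank_eq_three`); the ONLY remaining named hypotheses are
Gross–Zagier–Kolyvagin `hGZK` (bsd.S17) and, per row, the engine-side certificate fields `L‴(E_r,1) ≠ 0` and `w(E_r) = −1`.
[cite: CremonaAlgorithms1997, §2.13] [cite: Darmon2004, Thm. 3.22] -/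
theorem analyticRank_eq_three (hGZK : rank_eq_analyticRank_of_analyticRank_le_one) :
    ∀ r ∈ rows, iteratedDeriv 3 r.curve.entireLFunction 1 ≠ 0 → r.curve.rootNumber = -1 →
      r.curve.analyticRank = r.curve.mordellWeilRank ∧ r.curve.analyticRank = 3 := by
  intro r hr hL3 hw
  have h := Rank3Row.analyticRank_eq_rank_of_three_le (mem_rank3Table r hr) (rank_eq_three r hr).ge hGZK
    (rank_eq_three r hr).le hL3 hw
  exact ⟨h, h.trans (rank_eq_three r hr)⟩

end Summit.BirchSwinnertonDyer.BirchSwinnertonDyer.Rank2Observatory.TwoDescRank3Census.Final
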